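import Summits.HodgeConjecture.HodgeConjecture.Cruxes.BlochSeedDiscOne.IntegralityGap

/-!
# DualSupportHonest — the SUPPORT-HONEST node beside `FloorFree` (the ceiling of every support-indicator hierarchy)

Evidence-side typed node for the floors `FloorFree h 199 8` (h = 6 … 14) of `HeightTower.nonex_14_iff_floors`
(plan-lens-HodgeAV-dual g10, 2026-08-30; I3 = «lift-and-project ∕ Sherali–Adams ∕ Lasserre on the floor polytope»).
Letters ≠ sheaves ≠ a SEED; nothing here is a theorem toward HC ∕ HC_CM ∕ HC_AV ∕ №4 ∕ 26512 ∕ 18881 ∕ H2, and nothing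
here proves a floor: the file TYPES the intermediate node and proves the sandwich around it.

THE NODE.  A design is HONEST AT SCALE `q` if every entry it uses has multiplicity `≥ q`.  An integer design is honest at
scale 1 for free (`honest_one`), so `FloorFreeScaled h B r 1 ↔ DepthBound h B r (h − 1)` (`scaled_one_iff_depthBound`)
`↔ HeightTower.FloorFree h B r` (`HeightTower.floorFree_iff_depthBound`; linkage in `DualSupportHonestTower.lean`).  A RATIONAL
design with common denominator `q` whose every used cell carries mass `≥ 1` is — after clearing denominators — exactly an
integer design that is honest at scale `q` with `copies ≤ B·q`, `rank ≥ r·q`; (A1), (A4), `μ ≠ 0` and the alphabet are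
scale-invariant.  Hence

* `FloorFreeLP h B r`  (all scales, no honesty)  = «the plain LP relaxation of the floor is empty»
                        — FALSE at every floor h = 6 … 14 (R19.417 ∕ R19.419: exact rational pseudo-designs, (A4)-exact);
* `FloorFreeSH h B r`  (all scales, honest)      = «the SUPPORT-HONEST (fixed-charge) relaxation is empty»: no real design
                        whose support is (A4)-admissible as a SET, every used cell carrying mass ≥ 1, total mass ≤ B;
* `FloorFree h B r`    (scale 1)                 = the floor itself;

with `FloorFreeLP → FloorFreeSH → DepthBound h B r (h−1) = FloorFree` (`SH_of_LP`, `depthBound_of_SH`).  WHY THIS IS THE I3 NODE: every hierarchy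
that lifts the 0∕1 SUPPORT INDICATORS `u_c` (`u_c ≤ m_c ≤ B·u_c`) — Sherali–Adams, Lovász–Schrijver, Lasserre∕SOS, BCC
lift-and-project — produces at level k a convex set containing the mixed-integer hull `conv{(u,m) : u ∈ {0,1}}`, and that
hull projects onto exactly the support-honest real designs.  So a u-hierarchy refutes a floor at SOME level iff
`FloorFreeSH` holds (finite convergence at level = number of indicator variables), and at no level can it prove more.
`FloorFreeSH` is therefore the common ceiling of I3 and the exact object the Benders ∕ branch-and-cut masters of record
decide support by support; `BigSupport` (every floor-touching admissible support has more than `B` entries) is the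
combinatorial sufficient condition (`SH_of_bigSupport`), which is how the symmetric rooms of record died (`DBSym*`,
`DeepCellBudget`: the N-cover of an honest deep P-cell costs more than the budget).
-/

set_option linter.dupNamespace false
set_option autoImplicit false

namespace Summit.HodgeConjecture.HodgeConjecture.Cruxes.BlochSeedDiscOne.DualSupportHonest

open DepthBoundA4 IntegralityGap

/-- HONEST AT SCALE `q`: every entry with positive multiplicity has multiplicity `≥ q`. -/
def Honest (D : Design) (q : ℕ) : Prop := ∀ cm ∈ D.N ++ D.P, 0 < cm.2 → q ≤ cm.2

/-- every integer design is honest at scale 1. -/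
theorem honest_one (D : Design) : Honest D 1 := fun _ _ h => h

/-- SCALED FLOOR-FREE at scale `q`: no (A1)-clean (A4) design with `μ ≠ 0`, copies `≤ B·q`, rank `≥ rmin·q` on the
height-`h` alphabet that is honest at scale `q` uses a floor letter (`a = 0`).  Scale 1 is `FloorFree`. -/
def FloorFreeScaled (h : ℤ) (B : ℕ) (rmin : ℤ) (q : ℕ) : Prop :=
  ∀ D : Design, D.OnAlphabet h → D.A1 → D.A4 → D.mu ≠ 0 → D.copies ≤ B * q → rmin * (q : ℤ) ≤ D.rank →
    Honest D q → ∀ c ∈ D.suppN ++ D.suppP, ∀ f : Fin 4, 0 < (c f).a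

/-- RATIONAL FLOOR-FREE at scale `q`: the same WITHOUT honesty (integer designs read as rational designs of total mass
`≤ B`, rank `≥ rmin` after dividing by `q`). -/
def FloorFreeRat (h : ℤ) (B : ℕ) (rmin : ℤ) (q : ℕ) : Prop :=
  ∀ D : Design, D.OnAlphabet h → D.A1 → D.A4 → D.mu ≠ 0 → D.copies ≤ B * q → rmin * (q : ℤ) ≤ D.rank →
    ∀ c ∈ D.suppN ++ D.suppP, ∀ f : Fin 4, 0 < (c f).a

/-- SUPPORT-HONEST FLOOR-FREE: every scale, honest — the fixed-charge relaxation of the floor is empty. -/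
def FloorFreeSH (h : ℤ) (B : ℕ) (rmin : ℤ) : Prop := ∀ q : ℕ, 0 < q → FloorFreeScaled h B rmin q

/-- LP FLOOR-FREE: every scale, no honesty — the plain LP relaxation of the floor is empty. -/
def FloorFreeLP (h : ℤ) (B : ℕ) (rmin : ℤ) : Prop := ∀ q : ℕ, 0 < q → FloorFreeRat h B rmin q

/-- BIG SUPPORT: every (A1)-clean (A4) design with `μ ≠ 0` on the height-`h` alphabet that uses a floor letter has MORE
than `B` support entries (scale-free, budget-free, rank-free). -/
def BigSupport (h : ℤ) (B : ℕ) : Prop :=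
  ∀ D : Design, D.OnAlphabet h → D.A1 → D.A4 → D.mu ≠ 0 →
    (∃ c ∈ D.suppN ++ D.suppP, ∃ f : Fin 4, (c f).a = 0) → B < (D.suppN ++ D.suppP).length

/-! ## The sandwich `FloorFreeLP → FloorFreeSH → FloorFree` and `BigSupport → FloorFreeSH` -/

theorem scaled_of_rat {h : ℤ} {B : ℕ} {rmin : ℤ} {q : ℕ} (H : FloorFreeRat h B rmin q) : FloorFreeScaled h B rmin q :=
  fun D hA h1 h4 hμ hB hr _ => H D hA h1 h4 hμ hB hr

theorem SH_of_LP {h : ℤ} {B : ℕ} {rmin : ℤ} (H : FloorFreeLP h B rmin) : FloorFreeSH h B rmin :=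
  fun q hq => scaled_of_rat (H q hq)

/-- scale 1 is the floor: `FloorFreeScaled h B r 1` is the depth bound `c₀ = h − 1` of `DepthBoundA4` (deepest-ring exclusion), hence
— composing with `HeightTower.floorFree_iff_depthBound` — `HeightTower.FloorFree h B r` itself (linkage file `DualSupportHonestTower.lean`). -/
theorem scaled_one_iff_depthBound (h : ℤ) (B : ℕ) (rmin : ℤ) : FloorFreeScaled h B rmin 1 ↔ DepthBound h B rmin (h - 1) := by
  constructor
  · intro H D hA h1 h4 hμ hB hr c hc f
    have ha := H D hA h1 h4 hμ (by simpa using hB) (by simpa using hr) (honest_one D) c hc f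
    have hh := (hA c hc f).1
    unfold Letter.height at hh
    unfold Letter.colevel
    linarith
  · intro H D hA h1 h4 hμ hB hr _ c hc f
    have hcl := H D hA h1 h4 hμ (by simpa using hB) (by simpa using hr) c hc f
    have hh := (hA c hc f).1
    unfold Letter.height at hh
    unfold Letter.colevel at hcl
    linarith

/-- the support-honest node closes the floor (as the depth bound `h − 1`). -/
theorem depthBound_of_SH {h : ℤ} {B : ℕ} {rmin : ℤ} (H : FloorFreeSH h B rmin) : DepthBound h B rmin (h - 1) :=
  (scaled_one_iff_depthBound h B rmin).1 (H 1 Nat.one_pos)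

theorem depthBound_of_LP {h : ℤ} {B : ℕ} {rmin : ℤ} (H : FloorFreeLP h B rmin) : DepthBound h B rmin (h - 1) :=
  depthBound_of_SH (SH_of_LP H)

/-- honest mass count on one side: `q · #(support entries) ≤ Σ m`. -/
theorem mass_ge_of_honest (q : ℕ) : ∀ l : List (Cell × ℕ), (∀ cm ∈ l, 0 < cm.2 → q ≤ cm.2) →
    q * ((l.filter fun cm => 0 < cm.2).map Prod.fst).length ≤ (l.map Prod.snd).sum
  | [], _ => by simp
  | (c, m) :: t, hl => by
      have ht : ∀ cm ∈ t, 0 < cm.2 → q ≤ cm.2 := fun cm hcm => hl cm (List.mem_cons_of_mem _ hcm)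
      have ih := mass_ge_of_honest q t ht
      by_cases hm : 0 < m
      · have hq : q ≤ m := hl (c, m) (by simp) hm
        have e : ((((c, m) :: t).filter fun cm => 0 < cm.2).map Prod.fst).length
            = ((t.filter fun cm => 0 < cm.2).map Prod.fst).length + 1 := by
          simp [hm]
        rw [e, List.map_cons, List.sum_cons, Nat.mul_succ]
        omega
      · have hm0 : m = 0 := by omega
        subst hm0
        have e : ((((c, 0) :: t).filter fun cm => 0 < cm.2).map Prod.fst).length
            = ((t.filter fun cm => 0 < cm.2).map Prod.fst).length := by
          simp
        rw [e, List.map_cons, List.sum_cons]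
        omega

/-- honest mass count: `q · #(support entries) ≤ copies`. -/
theorem copies_ge_of_honest (D : Design) (q : ℕ) (hH : Honest D q) :
    q * (D.suppN ++ D.suppP).length ≤ D.copies := by
  have hN := mass_ge_of_honest q D.N (fun cm hcm => hH cm (List.mem_append.2 (Or.inl hcm)))
  have hP := mass_ge_of_honest q D.P (fun cm hcm => hH cm (List.mem_append.2 (Or.inr hcm)))
  unfold Design.copies
  unfold Design.suppN Design.suppP
  rw [List.length_append, Nat.mul_add]
  exact Nat.add_le_add hN hP

/-- BIG SUPPORT closes the support-honest node (for every rank threshold). -/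
theorem SH_of_bigSupport {h : ℤ} {B : ℕ} (rmin : ℤ) (H : BigSupport h B) : FloorFreeSH h B rmin := by
  intro q hq D hA h1 h4 hμ hB _ hH c hc f
  by_contra hneg
  have ha0 : (c f).a = 0 := by
    have hge := (hA c hc f).2
    omega
  have hbig := H D hA h1 h4 hμ ⟨c, hc, f, ha0⟩
  have hmass := copies_ge_of_honest D q hH
  have h1' : q * (B + 1) ≤ q * (D.suppN ++ D.suppP).length := Nat.mul_le_mul_left q hbig
  have h2' : q * (B + 1) ≤ B * q := le_trans (le_trans h1' hmass) hB
  have h3' : q * (B + 1) = B * q + q := by ring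
  omega

/-! ## Monotonicity in the budget and the rank threshold (the node is a family in `B`, `rmin`, like the floor) -/

theorem scaled_mono {h : ℤ} {B B' : ℕ} {rmin rmin' : ℤ} {q : ℕ} (hB : B' ≤ B) (hr : rmin ≤ rmin')
    (H : FloorFreeScaled h B rmin q) : FloorFreeScaled h B' rmin' q := by
  intro D hA h1 h4 hμ hB' hr' hH
  refine H D hA h1 h4 hμ (le_trans hB' (Nat.mul_le_mul_right q hB)) ?_ hH
  have : rmin * (q : ℤ) ≤ rmin' * (q : ℤ) := mul_le_mul_of_nonneg_right hr (by positivity)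
  exact le_trans this hr'

theorem SH_mono {h : ℤ} {B B' : ℕ} {rmin rmin' : ℤ} (hB : B' ≤ B) (hr : rmin ≤ rmin')
    (H : FloorFreeSH h B rmin) : FloorFreeSH h B' rmin' :=
  fun q hq => scaled_mono hB hr (H q hq)

end Summit.HodgeConjecture.HodgeConjecture.Cruxes.BlochSeedDiscOne.DualSupportHonest
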